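import Literature.NumberTheory.Irrationality.Fischler2002.RhinViolaGroupsGeneral
import HarnessLib

/-!
# Fischler 2002, Théorème 3.2 — brick IVa: the wreath product `𝔖₃ ≀ ℤ/2 ≤ 𝔖₆` has order `72`; block bookkeeping

Topic `Literature/NumberTheory/Irrationality/Fischler2002`. PROOFS ONLY (no definition, no statement): the finite-group half of
brick IV (`Theoreme32OrderFourProofs.lean`) toward the named fact `theoreme32` of `RhinViolaGroupsGeneral.lean` — for `n ≥ 4`
Fischler's group `⟨σ, ψ, φ⟩` acts on six linear forms through `(0 2)`, `(4 5)`, `(0 3)(1 4)(2 5) ∈ 𝔖₆`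
[Fischler2002Polyzetas, §3 Théorème 3.2: « pour `n ≥ 4`, ce groupe est isomorphe à `(𝔖₃ × 𝔖₃) ⋊ ℤ/2ℤ`, donc d'ordre 72 »;
Fischler2003RhinViola §3.4 Th. 6]. Here: `card_closure_wreath` — the subgroup of `Perm (Fin 6)` generated by these three
permutations has `Nat.card = 72` (its 72 elements listed as words found by breadth-first search, closure under the generators and
the count checked BY THE KERNEL with `decide +kernel` on explicit permutations of six symbols — no enumeration of `𝔖₆` beyond that,
no `native_decide`), the propositional bookkeeping of the two blocks `{0,1,2}`, `{3,4,5}` (`blocks_mul`, `blocks_inv`), and the inert coordinates of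
`⟨σ', ψ', φ'⟩` for `n ≥ 4` (`inert4_of_mem`: `a_k, b_k` for `k = 0` or `k > n`, `c_k` for `k ≤ 1` or `k > n` are fixed).
Cell `pub-zeta5`, seat ct-1 g33, 2026-08-28.

HONEST FRAMING (cell pub-zeta5): systematic search; no irrationality claim — pure finite group theory; nothing about `ζ(5)`.
-/

namespace Literature.NumberTheory.Irrationality.Fischler2002

namespace Theoreme32

open Equiv

/-! ### The image: `𝔖₃ ≀ ℤ/2 ≤ 𝔖₆` has order `72` -/

/-- **`|⟨(0 2), (4 5), (0 3)(1 4)(2 5)⟩| = 72`** in `Perm (Fin 6)`: the 72 words below (breadth-first) are closed under left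
multiplication by the three generators and pairwise distinct — checked by the kernel on explicit permutations of six symbols.
[cite: Fischler2003RhinViola, §3.4 Théorème 6 (ordre 72)] -/
theorem card_closure_wreath :
    Nat.card (Subgroup.closure ({swap (0 : Fin 6) 2, swap (4 : Fin 6) 5,
      swap (0 : Fin 6) 3 * swap (1 : Fin 6) 4 * swap (2 : Fin 6) 5} : Set (Perm (Fin 6)))) = 72 := by
  set S : Set (Perm (Fin 6)) := {swap (0 : Fin 6) 2, swap (4 : Fin 6) 5,
      swap (0 : Fin 6) 3 * swap (1 : Fin 6) 4 * swap (2 : Fin 6) 5} with hS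
  let g : Fin 3 → Perm (Fin 6) := ![swap 0 2, swap 4 5, swap 0 3 * swap 1 4 * swap 2 5]
  let W : List (List (Fin 3)) := [[], [0], [1], [2], [1, 0], [2, 0], [2, 1], [0, 2], [1, 2], [2, 1, 0], [0, 2, 0], [1, 2, 0],
    [0, 2, 1], [1, 2, 1], [1, 0, 2], [2, 0, 2], [2, 1, 2], [0, 2, 1, 0], [1, 2, 1, 0], [1, 0, 2, 0], [2, 0, 2, 0], [2, 1, 2, 0],
    [1, 0, 2, 1], [2, 0, 2, 1], [2, 1, 2, 1], [2, 1, 0, 2], [1, 2, 0, 2], [0, 2, 1, 2], [1, 0, 2, 1, 0], [2, 0, 2, 1, 0],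
    [2, 1, 2, 1, 0], [2, 1, 0, 2, 0], [1, 2, 0, 2, 0], [0, 2, 1, 2, 0], [2, 1, 0, 2, 1], [1, 2, 0, 2, 1], [0, 2, 1, 2, 1],
    [0, 2, 1, 0, 2], [1, 2, 1, 0, 2], [2, 1, 2, 0, 2], [2, 0, 2, 1, 2], [2, 1, 0, 2, 1, 0], [1, 2, 0, 2, 1, 0],
    [0, 2, 1, 2, 1, 0], [0, 2, 1, 0, 2, 0], [1, 2, 1, 0, 2, 0], [2, 1, 2, 0, 2, 0], [2, 0, 2, 1, 2, 0], [0, 2, 1, 0, 2, 1],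
    [1, 2, 1, 0, 2, 1], [2, 1, 2, 0, 2, 1], [2, 0, 2, 1, 2, 1], [1, 0, 2, 1, 0, 2], [2, 0, 2, 1, 0, 2], [2, 1, 2, 1, 0, 2],
    [0, 2, 1, 0, 2, 1, 0], [1, 2, 1, 0, 2, 1, 0], [2, 1, 2, 0, 2, 1, 0], [2, 0, 2, 1, 2, 1, 0], [1, 0, 2, 1, 0, 2, 0],
    [2, 0, 2, 1, 0, 2, 0], [2, 1, 2, 1, 0, 2, 0], [1, 0, 2, 1, 0, 2, 1], [2, 0, 2, 1, 0, 2, 1], [2, 1, 2, 1, 0, 2, 1],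
    [2, 1, 0, 2, 1, 0, 2], [1, 0, 2, 1, 0, 2, 1, 0], [2, 0, 2, 1, 0, 2, 1, 0], [2, 1, 2, 1, 0, 2, 1, 0], [2, 1, 0, 2, 1, 0, 2, 0],
    [2, 1, 0, 2, 1, 0, 2, 1], [2, 1, 0, 2, 1, 0, 2, 1, 0]]
  let E : Finset (Perm (Fin 6)) := (W.map fun w => (w.map g).prod).toFinset
  have hg : ∀ i, g i ∈ Subgroup.closure S := by
    intro i
    fin_cases i <;> exact Subgroup.subset_closure (by simp [hS, g])
  have hE_sub : ∀ x ∈ E, x ∈ Subgroup.closure S := by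
    intro x hx
    simp only [E, List.mem_toFinset, List.mem_map] at hx
    obtain ⟨w, -, rfl⟩ := hx
    refine Subgroup.list_prod_mem _ fun y hy => ?_
    simp only [List.mem_map] at hy
    obtain ⟨i, -, rfl⟩ := hy
    exact hg i
  have h1 : (1 : Perm (Fin 6)) ∈ E := by decide +kernel
  have hmul : ∀ y ∈ E, swap (0 : Fin 6) 2 * y ∈ E ∧ swap (4 : Fin 6) 5 * y ∈ E ∧
      swap (0 : Fin 6) 3 * swap (1 : Fin 6) 4 * swap (2 : Fin 6) 5 * y ∈ E := by decide +kernel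
  have hinv : (swap (0 : Fin 6) 2)⁻¹ = swap 0 2 ∧ (swap (4 : Fin 6) 5)⁻¹ = swap 4 5 ∧
      (swap (0 : Fin 6) 3 * swap (1 : Fin 6) 4 * swap (2 : Fin 6) 5)⁻¹ = swap 0 3 * swap 1 4 * swap 2 5 := by decide
  have hcl : ∀ x ∈ Subgroup.closure S, x ∈ E := by
    intro x hx
    induction hx using Subgroup.closure_induction_left with
    | one => exact h1
    | mul_left x hx y hy ih =>
      simp only [hS, Set.mem_insert_iff, Set.mem_singleton_iff] at hx
      rcases hx with rfl | rfl | rfl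
      · exact (hmul y ih).1
      · exact (hmul y ih).2.1
      · rw [mul_assoc, mul_assoc, ← mul_assoc (swap 1 4), ← mul_assoc]; exact (hmul y ih).2.2
    | inv_mul_cancel x hx y hy ih =>
      simp only [hS, Set.mem_insert_iff, Set.mem_singleton_iff] at hx
      rcases hx with rfl | rfl | rfl
      · rw [hinv.1]; exact (hmul y ih).1
      · rw [hinv.2.1]; exact (hmul y ih).2.1
      · rw [hinv.2.2, mul_assoc, mul_assoc, ← mul_assoc (swap 1 4), ← mul_assoc]; exact (hmul y ih).2.2
  have hset : (Subgroup.closure S : Set (Perm (Fin 6))) = ↑E := Set.ext fun x => ⟨hcl x, hE_sub x⟩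
  rw [← SetLike.coe_sort_coe, hset, Nat.card_coe_set_eq, Set.ncard_coe_finset]
  decide +kernel

/-! ### Block bookkeeping in `𝔖₆` (blocks `{0,1,2}` and `{3,4,5}`) -/

/-- Products of block-preserving permutations are block-preserving, and «exchanges the blocks» is additive.
[cite: Fischler2003RhinViola, §3.4 Théorème 6 (structure (𝔖₃×𝔖₃)⋊ℤ/2)] -/
theorem blocks_mul {π τ : Perm (Fin 6)} (hπ : ∀ x : Fin 6, (π x).val < 3 ↔ (x.val < 3 ↔ (π 0).val < 3))
    (hτ : ∀ x : Fin 6, (τ x).val < 3 ↔ (x.val < 3 ↔ (τ 0).val < 3)) :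
    (∀ x : Fin 6, ((τ * π) x).val < 3 ↔ (x.val < 3 ↔ ((τ * π) 0).val < 3)) ∧
      (3 ≤ ((τ * π) 0).val ↔ ¬ (3 ≤ (π 0).val ↔ 3 ≤ (τ 0).val)) := by
  have h0 : ((τ * π) 0).val < 3 ↔ ((π 0).val < 3 ↔ (τ 0).val < 3) := by rw [Perm.mul_apply]; exact hτ _
  refine ⟨fun x => ?_, ?_⟩
  · rw [Perm.mul_apply, hτ, hπ, Perm.mul_apply, hτ]; tauto
  · rw [← not_lt, ← not_lt, ← not_lt, h0]; tauto

/-- Inverses of block-preserving permutations are block-preserving, with the same block-exchange flag.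
[cite: Fischler2003RhinViola, §3.4 Théorème 6 (structure (𝔖₃×𝔖₃)⋊ℤ/2)] -/
theorem blocks_inv {π : Perm (Fin 6)} (hπ : ∀ x : Fin 6, (π x).val < 3 ↔ (x.val < 3 ↔ (π 0).val < 3)) :
    (∀ x : Fin 6, (π⁻¹ x).val < 3 ↔ (x.val < 3 ↔ (π⁻¹ 0).val < 3)) ∧ (3 ≤ (π⁻¹ 0).val ↔ 3 ≤ (π 0).val) := by
  have h0 : (π⁻¹ 0).val < 3 ↔ (π 0).val < 3 := by
    have h := hπ (π⁻¹ 0)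
    simp only [Perm.coe_inv, Equiv.apply_symm_apply, Fin.val_zero, Nat.zero_lt_succ, true_iff] at h ⊢
    tauto
  refine ⟨fun x => ?_, by rw [← not_lt, ← not_lt, h0]⟩
  have h := hπ (π⁻¹ x)
  simp only [Perm.coe_inv, Equiv.apply_symm_apply] at h h0 ⊢
  rw [h0]; tauto

section Inert

variable {n : ℕ} {gσ gψ gφ : Perm {p : Exponents // InE n p}}

/-! ### The inert coordinates are fixed -/

/-- Every element of `⟨σ', ψ', φ'⟩` (`n ≥ 4`) fixes `a_k, b_k` for `k = 0` or `k > n` and `c_k` for `k ≤ 1` or `k > n`.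
[cite: Fischler2002Polyzetas, §3 Théorème 3.2 (n ≥ 4)] -/
theorem inert4_of_mem (hn : 4 ≤ n) (hσ : ∀ p, (gσ p).1 = sigma p.1) (hψ : ∀ p, (gψ p).1 = psi n p.1)
    (hφ : ∀ p, (gφ p).1 = phi n p.1) {g : Perm {p : Exponents // InE n p}}
    (hg : g ∈ Subgroup.closure ({gσ, gψ, gφ} : Set (Perm {p : Exponents // InE n p}))) (p : {p : Exponents // InE n p}) :
    (∀ k, k = 0 ∨ n < k → (g p).1.a k = p.1.a k) ∧ (∀ k, k = 0 ∨ n < k → (g p).1.b k = p.1.b k) ∧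
      (∀ k, k ≤ 1 ∨ n < k → (g p).1.c k = p.1.c k) := by
  induction hg using Subgroup.closure_induction generalizing p with
  | mem x hx =>
    simp only [Set.mem_insert_iff, Set.mem_singleton_iff] at hx
    rcases hx with rfl | rfl | rfl
    · rw [hσ p]
      refine ⟨fun k hk => ?_, fun k hk => ?_, fun k _ => rfl⟩
      · simp only [sigma, if_neg (show k ≠ 1 by omega), if_neg (show k ≠ 2 by omega)]
      · simp only [sigma, if_neg (show k ≠ 1 by omega), if_neg (show k ≠ 2 by omega)]
    · rw [hψ p]
      refine ⟨fun k hk => ?_, fun k hk => ?_, fun k hk => ?_⟩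
      · simp only [psi, if_neg (show ¬ (1 ≤ k ∧ k ≤ n) by omega)]
      · simp only [psi, if_neg (show k ≠ 1 by omega), if_neg (show ¬ (2 ≤ k ∧ k ≤ n) by omega)]
      · simp only [psi, if_neg (show ¬ (2 ≤ k ∧ k ≤ n - 1) by omega), if_neg (show k ≠ n by omega)]
    · rw [hφ p]
      refine ⟨fun k hk => ?_, fun k hk => ?_, fun k hk => ?_⟩
      · simp only [phi, if_neg (show k ≠ n - 1 by omega)]
      · simp only [phi, if_neg (show k ≠ n - 1 by omega), if_neg (show k ≠ n by omega)]
      · simp only [phi, if_neg (show k ≠ n by omega)]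
  | one => exact ⟨fun k _ => rfl, fun k _ => rfl, fun k _ => rfl⟩
  | mul x y _ _ ihx ihy =>
    obtain ⟨ha, hb, hc⟩ := ihx (y p)
    obtain ⟨ha', hb', hc'⟩ := ihy p
    refine ⟨fun k hk => ?_, fun k hk => ?_, fun k hk => ?_⟩
    · rw [Perm.mul_apply, ha k hk, ha' k hk]
    · rw [Perm.mul_apply, hb k hk, hb' k hk]
    · rw [Perm.mul_apply, hc k hk, hc' k hk]
  | inv x _ ihx =>
    obtain ⟨ha, hb, hc⟩ := ihx (x⁻¹ p)
    simp only [Perm.coe_inv, Equiv.apply_symm_apply] at ha hb hc ⊢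
    exact ⟨fun k hk => (ha k hk).symm, fun k hk => (hb k hk).symm, fun k hk => (hc k hk).symm⟩

end Inert

end Theoreme32

end Literature.NumberTheory.Irrationality.Fischler2002
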